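/-
Copyright (c) 2026 the pub-hodgecm-mathlib formalisation cell (harness21).  Prover seat hodgecm-mathlib-K2E1-p15 (g0), Track B ∕ K2-LIT «5Res (c)∕(d)», h413 = `stmt-HodgeConjecture-24833`,
line `K2_E1_TraceFormulaBeta`, route of record `HCCMUnconditional`; DESK-FREE offer (a) on the K2 bus 2026-09-04T12:07Z after the (d)-assembly ★ p860014: the LOWER-QUADRANT editions of
★ p859884 `K2E1ChiMaassSelbergContinuedOnBoxesCMTwo`, by REFLECTION `z ↦ conj z` through the D⁺ heads (no identity theorem re-run).
-/
import Summits.HodgeConjecture.HodgeConjecture.Theorems.K2E1ChiMaassSelbergContinuedOnBoxesCMTwo   -- ★ p859884 (this seat): `poleControl_continued_chi_cm_two_of_pairing_on'` (D⁺, general boxes)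
import HarnessLib

/-!
# K2·E1 — `K2E1ChiMaassSelbergContinuedLowerCMTwo`: POLE CONTROL OF `M(z, χ)` ON AN OPEN PRECONNECTED `D₁ ⊆ D⁻ = {½ < Re, Im < 0}` — the lower-quadrant editions of ★
# `K2E1ChiMaassSelbergContinuedOnBoxesCMTwo`, obtained by REFLECTION `z ↦ z̄` through the D⁺ heads

Track B ∕ K2-LIT, crux h413 = `stmt-HodgeConjecture-24833`; cell `hodgecm-mathlib`, squad K2, ENGINE E1, campaign «5Res», road «BL-2(χ,τ) ∘ MS-2(χ,τ) ∘ ARCH-UNITARITY ∘ R8₂».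
THEOREMS ONLY (no `def`, no `instance`, no notation, no named-fact hypothesis, no `sorry`); lane `--kind proof --supports stmt-HodgeConjecture-24833 --as helper` (count-neutral).
Closes no socket.

WHY ([MoeglinWaldspurger1995, IV.3.12 (a)]).  «No pole off the real axis in `½ < Re z`» has two halves: `Im z > 0` (★ p859658 ∕ p859884 ∕ p859971 ∕ p860014, domain `D₁ ⊆ D⁺`) and
`Im z < 0`.  The Maass–Selberg relation `⟪F z′, F z⟫ = R(z, z′; B)` on the sub-tube `1 < Re z′ < Re z` knows nothing about the sign of `Im`; the D⁺ restriction enters the ★ heads only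
through the non-vanishing of the denominators `z + w̄ − 1`, `z − w` on `D₁ × conj⁻¹D₁`.  For `D₁ ⊆ D⁻` we REFLECT: `D := conj⁻¹ D₁ ⊆ D⁺` is open and preconnected, the pairing
`Φ(u, u′) := ⟪F(ū), F(ū′)⟫ = conj ⟪F(ū′), F(ū)⟫` is separately holomorphic in the shape of ★ `poleControl_continued_chi_cm_two_of_pairing_on'`, and on the reflected boxes it equals
`conj R(ū, ū′; B) = R(u, u′; B⁻)` with the REFLECTED BRACKETS `B₂⁻ = conj ∘ B₂ ∘ conj`, `B₃⁻ = conj ∘ B₃ ∘ conj`, `B₄⁻(u, u′) = conj B₄(ū, ū′)`, `b⁻ = b ∘ conj` (§1 `conj_fourTerm`: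
`conj(T^s∕s) = T^{s̄}∕s̄` for `T > 0`), whose letters are the given ones read through ★ `differentiableOn_conj_comp_conj`.  The D⁺ head at `u = z̄` is the D⁻ statement at `z`
(`Re z̄ = Re z`, `|Im z̄| = |Im z|`).
* §1 `conj_cpow_ofReal` , **`conj_fourTerm`** (the reflection of the four-term right-hand side), `conj_preimage_conj_preimage`, `isPreconnected_conj_preimage`.
* §2 **`poleControl_continued_chi_cm_two_of_family_lower_on'`** (`F : ℂ → H`, `D₁ ⊆ D⁻`, general boxes) and **`poleControl_continued_chi_cm_two_of_truncatedFamily_lower_on'`**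
  (`F : ℂ → L²(X, μ)`, `hFtube`, socket `h4` = ★ row 14 FILE 1's relation VERBATIM — the same `h4` feeds both half-planes).
HONEST LABEL: HC_CM is proved only modulo the 7 printed citations (2 remaining named inputs: hLiu418 = `stmt-HodgeConjecture-24832`, h413 = `stmt-HodgeConjecture-24833`) until rung 0
closes; this file asserts no named fact, is conditional by construction on the relation letters (`hrel` ∕ `h4`), and closes no socket.

## References
* [MoeglinWaldspurger1995] C. Mœglin, J.-L. Waldspurger, *Spectral decomposition and Eisenstein series* (1995), IV.2.3, IV.3.12 (a).
* [Arthur1980TraceFormulaII] J. Arthur, *A trace formula for reductive groups II*, Compositio Math. 40 (1980), §4.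
* [BernsteinLapid2019] J. Bernstein, E. Lapid, *On the meromorphic continuation of Eisenstein series*, J. AMS 37 (2024), Thm 2.3, §4.
-/

set_option autoImplicit false
set_option linter.dupNamespace false  -- the mandated namespace repeats the summit's segment (`HodgeConjecture.HodgeConjecture`)

noncomputable section

open MeasureTheory Measure NumberField IsDedekindDomain Set Filter Topology
open scoped ENNReal NNReal ComplexConjugate InnerProductSpace
open Literature.NumberTheory.Automorphic Literature.NumberTheory.Automorphic.UnitaryGroup AdelicGroupData
open Summit.HodgeConjecture.HodgeConjecture.Cruxes.H413.K2E1BorelEisensteinU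
open Summit.HodgeConjecture.HodgeConjecture.Cruxes.H413.K2E1MaassSelbergContinuedCMTwo (differentiableOn_conj_comp_conj)
open Summit.HodgeConjecture.HodgeConjecture.Cruxes.H413.K2E1ChiMaassSelbergContinuedModelsCMTwo (inner_self_eq_ofReal_norm_sq)
open Summit.HodgeConjecture.HodgeConjecture.Cruxes.H413.K2E1ChiMaassSelbergContinuedOnBoxesCMTwo (poleControl_continued_chi_cm_two_of_pairing_on')

namespace Summit.HodgeConjecture.HodgeConjecture.Cruxes.H413.K2E1ChiMaassSelbergContinuedLowerCMTwo

/-! ## §1 Reflection lemmas -/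

section Reflection

/-- `conj (T^s) = T^{conj s}` for a positive real base. [folklore] -/
theorem conj_cpow_ofReal {T : ℝ} (hT : 0 < T) (s : ℂ) : conj (((T : ℝ) : ℂ) ^ s) = ((T : ℝ) : ℂ) ^ conj s := by
  have harg : ((T : ℝ) : ℂ).arg ≠ Real.pi := by
    rw [Complex.arg_ofReal_of_nonneg hT.le]; exact Real.pi_pos.ne
  rw [Complex.cpow_conj _ _ harg, Complex.conj_ofReal]

/-- **THE REFLECTED FOUR-TERM RIGHT-HAND SIDE**: `conj R(z̄, z̄′; B₁, W, B₃, B₄) = R(z, z′; conj B₁, conj W, conj B₃, conj B₄)` (`T > 0` real, real scalars `cμ, K`). [cite: MoeglinWaldspurger1995, IV.2.3] -/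
theorem conj_fourTerm {T : ℝ} (hT : 0 < T) (cμ K : ℝ) (B₁ W B₃ B₄ z z' : ℂ) :
    conj (((cμ : ℝ) : ℂ) * (((K : ℝ) : ℂ) *
        ((((T : ℝ) : ℂ) ^ (conj z + conj (conj z') - 1) / (conj z + conj (conj z') - 1)) * B₁
          + (((T : ℝ) : ℂ) ^ (conj z - conj (conj z')) / (conj z - conj (conj z'))) * W
          - (((T : ℝ) : ℂ) ^ (-(conj z - conj (conj z'))) / (conj z - conj (conj z'))) * B₃
          - (((T : ℝ) : ℂ) ^ (-(conj z + conj (conj z') - 1)) / (conj z + conj (conj z') - 1)) * B₄))) =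
      ((cμ : ℝ) : ℂ) * (((K : ℝ) : ℂ) *
        ((((T : ℝ) : ℂ) ^ (z + conj z' - 1) / (z + conj z' - 1)) * conj B₁
          + (((T : ℝ) : ℂ) ^ (z - conj z') / (z - conj z')) * conj W
          - (((T : ℝ) : ℂ) ^ (-(z - conj z')) / (z - conj z')) * conj B₃
          - (((T : ℝ) : ℂ) ^ (-(z + conj z' - 1)) / (z + conj z' - 1)) * conj B₄)) := by
  simp only [map_mul, map_add, map_sub, map_div₀, map_neg, map_one, conj_cpow_ofReal hT, Complex.conj_conj, Complex.conj_ofReal]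

/-- `conj⁻¹(conj⁻¹ D₁) = D₁`. [folklore] -/
theorem conj_preimage_conj_preimage (D₁ : Set ℂ) : {w : ℂ | conj w ∈ {u : ℂ | conj u ∈ D₁}} = D₁ := by
  ext w; simp only [Set.mem_setOf_eq, Complex.conj_conj]

/-- `conj⁻¹ D₁` is preconnected if `D₁` is (it is the image of `D₁` under the continuous involution `conj`). [folklore] -/
theorem isPreconnected_conj_preimage {D₁ : Set ℂ} (hD₁c : IsPreconnected D₁) : IsPreconnected {u : ℂ | conj u ∈ D₁} := by
  have himg : {u : ℂ | conj u ∈ D₁} = (fun z : ℂ => conj z) '' D₁ := by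
    ext u
    simp only [Set.mem_setOf_eq, Set.mem_image]
    constructor
    · intro h; exact ⟨conj u, h, Complex.conj_conj u⟩
    · rintro ⟨z, hz, rfl⟩; simpa only [Complex.conj_conj] using hz
  rw [himg]
  exact hD₁c.image _ Complex.continuous_conj.continuousOn

end Reflection

/-! ## §2 The lower-quadrant heads -/

section Lower

/-- **[MW] IV.3.12 (a) FOR `M(z, χ)` ON `D₁ ⊆ D⁻ = {½ < Re, Im < 0}`, HILBERT FAMILY FORM** — the reflection of ★ `poleControl_continued_chi_cm_two_of_family_on'`: `D₁ ⊆ D⁻` open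
preconnected, open non-empty boxes `O₁, O₂' ⊆ D₁` with `1 < Re z′ < Re z` across, bracket letters IN THE SAME SHAPES as the D⁺ head (`B₂`: `w ↦ B₂(w̄)` holomorphic on `conj⁻¹D₁`;
`B₃`, `B₄(·, z′)` holomorphic on `D₁`; `w ↦ B₄(z, w̄)` holomorphic on `conj⁻¹D₁`; `B₃ = conj B₂`, `B₄(z,z) = b(z)`, `‖B₂‖² ≤ a·b`), `F : ℂ → H` holomorphic on `D₁` with `⟪F z′, F z⟫ =
R(z, z′; B)` on the sub-tube inside `D₁ × D₁`.  THEN (a1)∧(a2)∧(a3) for `b` at every `z ∈ D₁` (`x = Re z − ½`, `|y| = |Im z|`).  Proof: the D⁺ head on `conj⁻¹D₁` for the pairing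
`Φ(u,u′) = ⟪F ū, F ū′⟫` and the reflected brackets, at `u = z̄`. [cite: MoeglinWaldspurger1995, IV.2.3, IV.3.12 (a)] [cite: Arthur1980TraceFormulaII, §4] -/
theorem poleControl_continued_chi_cm_two_of_family_lower_on' {D₁ : Set ℂ} (hD₁ : IsOpen D₁) (hD₁c : IsPreconnected D₁) (hD₁sub : D₁ ⊆ {z : ℂ | 1 / 2 < z.re ∧ z.im < 0})
    {O₁ O₂' : Set ℂ} (hO₁ : IsOpen O₁) (hO₁ne : O₁.Nonempty) (hO₁D : O₁ ⊆ D₁) (hO₂' : IsOpen O₂') (hO₂'ne : O₂'.Nonempty) (hO₂'D : O₂' ⊆ D₁)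
    (hsep : ∀ z ∈ O₁, ∀ z' ∈ O₂', 1 < z'.re ∧ z'.re < z.re)
    {T cμ K : ℝ} (hT : 1 ≤ T) (hcμ : 0 < cμ) (hK : 0 < K) {a : ℝ} (ha : 0 < a) {b : ℂ → ℝ} (hb : ∀ z ∈ D₁, 0 ≤ b z)
    {B₁ : ℂ} {B₂ B₃ : ℂ → ℂ} {B₄ : ℂ → ℂ → ℂ} (hB₁ : B₁ = ((a : ℝ) : ℂ)) (hB₂ : DifferentiableOn ℂ (fun w : ℂ => B₂ (conj w)) {w : ℂ | conj w ∈ D₁}) (hB₃ : DifferentiableOn ℂ B₃ D₁)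
    (hB₃₂ : ∀ z ∈ D₁, B₃ z = conj (B₂ z)) (hB₄₁ : ∀ z' ∈ D₁, DifferentiableOn ℂ (fun z : ℂ => B₄ z z') D₁)
    (hB₄₂ : ∀ z ∈ D₁, DifferentiableOn ℂ (fun w : ℂ => B₄ z (conj w)) {w : ℂ | conj w ∈ D₁}) (hB₄d : ∀ z ∈ D₁, B₄ z z = ((b z : ℝ) : ℂ))
    (hCS : ∀ z ∈ D₁, ‖B₂ z‖ ^ 2 ≤ a * b z)
    {H : Type*} [NormedAddCommGroup H] [InnerProductSpace ℂ H] (F : ℂ → H) (hFd : DifferentiableOn ℂ F D₁)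
    (hrel : ∀ z ∈ D₁, ∀ z' ∈ D₁, 1 < z'.re → z'.re < z.re →
      ⟪F z', F z⟫_ℂ = ((cμ : ℝ) : ℂ) * (((K : ℝ) : ℂ) *
        ((((T : ℝ) : ℂ) ^ (z + conj z' - 1) / (z + conj z' - 1)) * B₁
          + (((T : ℝ) : ℂ) ^ (z - conj z') / (z - conj z')) * B₂ z'
          - (((T : ℝ) : ℂ) ^ (-(z - conj z')) / (z - conj z')) * B₃ z
          - (((T : ℝ) : ℂ) ^ (-(z + conj z' - 1)) / (z + conj z' - 1)) * B₄ z z')))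
    {z : ℂ} (hz : z ∈ D₁) :
    Real.sqrt (b z) ≤ (z.re - 1 / 2) * T ^ (2 * (z.re - 1 / 2)) * Real.sqrt a / |z.im| +
        Real.sqrt ((z.re - 1 / 2) ^ 2 * T ^ (4 * (z.re - 1 / 2)) * a / z.im ^ 2 + a * T ^ (4 * (z.re - 1 / 2))) ∧
      (∀ {x₁ x₂ η : ℝ}, 0 < x₁ → (z.re - 1 / 2) ∈ Set.Icc x₁ x₂ → 0 < η → η ≤ |z.im| →
        b z ≤ (x₂ * T ^ (2 * x₂) * Real.sqrt a / η + Real.sqrt (x₂ ^ 2 * T ^ (4 * x₂) * a / η ^ 2 + a * T ^ (4 * x₂))) ^ 2) ∧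
      (|z.im| ≤ 1 → b z ≤ ((z.re - 1 / 2) * T ^ (2 * (z.re - 1 / 2)) * Real.sqrt a +
        Real.sqrt ((z.re - 1 / 2) ^ 2 * T ^ (4 * (z.re - 1 / 2)) * a + a * T ^ (4 * (z.re - 1 / 2)))) ^ 2 / z.im ^ 2) := by
  have hT0 : 0 < T := lt_of_lt_of_le one_pos hT
  -- the reflected domain `D = conj⁻¹ D₁ ⊆ D⁺` and boxes
  have hDo : IsOpen {u : ℂ | conj u ∈ D₁} := hD₁.preimage Complex.continuous_conj
  have hDc : IsPreconnected {u : ℂ | conj u ∈ D₁} := isPreconnected_conj_preimage hD₁c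
  have hDsub : {u : ℂ | conj u ∈ D₁} ⊆ {z : ℂ | 1 / 2 < z.re ∧ 0 < z.im} := by
    intro u hu
    obtain ⟨h1, h2⟩ := hD₁sub hu
    rw [Complex.conj_re] at h1
    rw [Complex.conj_im] at h2
    exact ⟨h1, by linarith⟩
  have hPo : IsOpen {u : ℂ | conj u ∈ O₁} := hO₁.preimage Complex.continuous_conj
  have hPne : ({u : ℂ | conj u ∈ O₁}).Nonempty := by
    obtain ⟨w, hw⟩ := hO₁ne; exact ⟨conj w, by simpa only [Set.mem_setOf_eq, Complex.conj_conj] using hw⟩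
  have hPD : {u : ℂ | conj u ∈ O₁} ⊆ {u : ℂ | conj u ∈ D₁} := fun u hu => hO₁D hu
  have hP'o : IsOpen {u : ℂ | conj u ∈ O₂'} := hO₂'.preimage Complex.continuous_conj
  have hP'ne : ({u : ℂ | conj u ∈ O₂'}).Nonempty := by
    obtain ⟨w, hw⟩ := hO₂'ne; exact ⟨conj w, by simpa only [Set.mem_setOf_eq, Complex.conj_conj] using hw⟩
  have hP'D : {u : ℂ | conj u ∈ O₂'} ⊆ {u : ℂ | conj u ∈ D₁} := fun u hu => hO₂'D hu
  have hsep' : ∀ u ∈ {u : ℂ | conj u ∈ O₁}, ∀ u' ∈ {u : ℂ | conj u ∈ O₂'}, 1 < u'.re ∧ u'.re < u.re := by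
    intro u hu u' hu'
    have h := hsep (conj u) hu (conj u') hu'
    simp only [Complex.conj_re] at h
    exact h
  -- the reflected bracket letters
  have hb' : ∀ u ∈ {u : ℂ | conj u ∈ D₁}, 0 ≤ b (conj u) := fun u hu => hb _ hu
  have hB₂' : DifferentiableOn ℂ (fun w : ℂ => conj (B₂ (conj (conj w)))) {w : ℂ | conj w ∈ {u : ℂ | conj u ∈ D₁}} :=
    differentiableOn_conj_comp_conj hDo hB₂
  have hB₃' : DifferentiableOn ℂ (fun u : ℂ => conj (B₃ (conj u))) {u : ℂ | conj u ∈ D₁} := differentiableOn_conj_comp_conj hD₁ hB₃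
  have hB₃₂' : ∀ u ∈ {u : ℂ | conj u ∈ D₁}, conj (B₃ (conj u)) = conj (conj (B₂ (conj u))) := fun u hu => by rw [hB₃₂ _ hu]
  have hB₄₁' : ∀ u' ∈ {u : ℂ | conj u ∈ D₁}, DifferentiableOn ℂ (fun u : ℂ => conj (B₄ (conj u) (conj u'))) {u : ℂ | conj u ∈ D₁} :=
    fun u' hu' => differentiableOn_conj_comp_conj hD₁ (hB₄₁ (conj u') hu')
  have hB₄₂' : ∀ u ∈ {u : ℂ | conj u ∈ D₁}, DifferentiableOn ℂ (fun w : ℂ => conj (B₄ (conj u) (conj (conj w)))) {w : ℂ | conj w ∈ {u : ℂ | conj u ∈ D₁}} :=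
    fun u hu => differentiableOn_conj_comp_conj hDo (hB₄₂ (conj u) hu)
  have hB₄d' : ∀ u ∈ {u : ℂ | conj u ∈ D₁}, conj (B₄ (conj u) (conj u)) = ((b (conj u) : ℝ) : ℂ) := fun u hu => by
    rw [hB₄d _ hu, Complex.conj_ofReal]
  have hCS' : ∀ u ∈ {u : ℂ | conj u ∈ D₁}, ‖conj (B₂ (conj u))‖ ^ 2 ≤ a * b (conj u) := fun u hu => by
    rw [RCLike.norm_conj]; exact hCS _ hu
  have hB₁' : conj B₁ = ((a : ℝ) : ℂ) := by rw [hB₁, Complex.conj_ofReal]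
  -- the reflected pairing `Φ(u, u') = ⟪F ū, F ū'⟫`
  have hΦ₁ : ∀ u' ∈ {u : ℂ | conj u ∈ D₁}, DifferentiableOn ℂ (fun u : ℂ => ⟪F (conj u), F (conj u')⟫_ℂ) {u : ℂ | conj u ∈ D₁} := by
    intro u' _
    have h := differentiableOn_conj_comp_conj hD₁ ((innerSL ℂ (F (conj u'))).differentiable.comp_differentiableOn hFd)
    refine h.congr fun u _ => ?_
    show ⟪F (conj u), F (conj u')⟫_ℂ = conj ⟪F (conj u'), F (conj u)⟫_ℂ
    exact (inner_conj_symm _ _).symm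
  have hΦ₂ : ∀ u ∈ {u : ℂ | conj u ∈ D₁}, DifferentiableOn ℂ (fun w : ℂ => ⟪F (conj u), F (conj (conj w))⟫_ℂ) {w : ℂ | conj w ∈ {u : ℂ | conj u ∈ D₁}} := by
    intro u _
    rw [conj_preimage_conj_preimage]
    exact ((innerSL ℂ (F (conj u))).differentiable.comp_differentiableOn hFd).congr fun w _ => by simp only [Complex.conj_conj]; rfl
  have hQ' : ∀ u ∈ {u : ℂ | conj u ∈ D₁}, 0 ≤ ‖F (conj u)‖ ^ 2 ∧ ⟪F (conj u), F (conj u)⟫_ℂ = (((‖F (conj u)‖ ^ 2 : ℝ)) : ℂ) :=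
    fun u _ => ⟨sq_nonneg _, inner_self_eq_ofReal_norm_sq _⟩
  have hrel' : ∀ u ∈ {u : ℂ | conj u ∈ D₁}, ∀ u' ∈ {u : ℂ | conj u ∈ D₁}, 1 < u'.re → u'.re < u.re →
      ⟪F (conj u), F (conj u')⟫_ℂ = ((cμ : ℝ) : ℂ) * (((K : ℝ) : ℂ) *
        ((((T : ℝ) : ℂ) ^ (u + conj u' - 1) / (u + conj u' - 1)) * conj B₁
          + (((T : ℝ) : ℂ) ^ (u - conj u') / (u - conj u')) * conj (B₂ (conj u'))
          - (((T : ℝ) : ℂ) ^ (-(u - conj u')) / (u - conj u')) * conj (B₃ (conj u))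
          - (((T : ℝ) : ℂ) ^ (-(u + conj u' - 1)) / (u + conj u' - 1)) * conj (B₄ (conj u) (conj u')))) := by
    intro u hu u' hu' h1 h2
    have h := hrel (conj u) hu (conj u') hu' (by rwa [Complex.conj_re]) (by simpa only [Complex.conj_re] using h2)
    rw [← inner_conj_symm, h, conj_fourTerm hT0]
  -- the D⁺ head at `u = conj z`
  have hzD : conj z ∈ {u : ℂ | conj u ∈ D₁} := by simpa only [Set.mem_setOf_eq, Complex.conj_conj] using hz
  have hmain := poleControl_continued_chi_cm_two_of_pairing_on' hDo hDc hDsub hPo hPne hPD hP'o hP'ne hP'D hsep' hT hcμ hK ha hb'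
    (B₁ := conj B₁) (B₂ := fun u' => conj (B₂ (conj u'))) (B₃ := fun u => conj (B₃ (conj u))) (B₄ := fun u u' => conj (B₄ (conj u) (conj u')))
    hB₁' hB₂' hB₃' hB₃₂' hB₄₁' hB₄₂' hB₄d' hCS' (Φ := fun u u' => ⟪F (conj u), F (conj u')⟫_ℂ) hΦ₁ hΦ₂ hrel' (Q := fun u => ‖F (conj u)‖ ^ 2) hQ' hzD
  simpa only [Complex.conj_conj, Complex.conj_re, Complex.conj_im, abs_neg, neg_sq] using hmain

variable (L : Type) [Field L] [NumberField L] [IsCMField L]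
variable [MeasurableSpace (quasiSplit (↥(maximalRealSubfield L)) L (IsCMField.complexConj L) 2).Adelic]

/-- **[MW] IV.3.12 (a) FOR `M(z, χ)` AT THE CM PAIR ON `D₁ ⊆ D⁻` FROM THE CONTINUED TRUNCATED FAMILY IN `L²(X, μ)` AND FILE 1's RELATION ON THE TUBE** — the lower-quadrant twin of ★
`poleControl_continued_chi_cm_two_of_truncatedFamily_on'` (same letters with `D₁ ⊆ D⁻`; the socket `h4` is FILE 1's relation VERBATIM, blind to the sign of `Im`).
[cite: MoeglinWaldspurger1995, IV.2.3, IV.3.12 (a)] [cite: Arthur1980TraceFormulaII, §4] -/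
theorem poleControl_continued_chi_cm_two_of_truncatedFamily_lower_on' {D₁ : Set ℂ} (hD₁ : IsOpen D₁) (hD₁c : IsPreconnected D₁) (hD₁sub : D₁ ⊆ {z : ℂ | 1 / 2 < z.re ∧ z.im < 0})
    {O₁ O₂' : Set ℂ} (hO₁ : IsOpen O₁) (hO₁ne : O₁.Nonempty) (hO₁D : O₁ ⊆ D₁) (hO₂' : IsOpen O₂') (hO₂'ne : O₂'.Nonempty) (hO₂'D : O₂' ⊆ D₁)
    (hsep : ∀ z ∈ O₁, ∀ z' ∈ O₂', 1 < z'.re ∧ z'.re < z.re)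
    (μ : Measure (quasiSplit (↥(maximalRealSubfield L)) L (IsCMField.complexConj L) 2).automorphicQuotient)
    (ν : Measure ↥(adelicUnipotent (↥(maximalRealSubfield L)) L (IsCMField.complexConj L) 2)) (𝓕 : Set ↥(adelicUnipotent (↥(maximalRealSubfield L)) L (IsCMField.complexConj L) 2))
    {T : ℝ≥0} (hT : 1 ≤ T) {cμ K : ℝ} (hcμ : 0 < cμ) (hK : 0 < K) {a : ℝ} (ha : 0 < a) {b : ℂ → ℝ} (hb : ∀ z ∈ D₁, 0 ≤ b z)
    {B₁ : ℂ} {B₂ B₃ : ℂ → ℂ} {B₄ : ℂ → ℂ → ℂ} (hB₁ : B₁ = ((a : ℝ) : ℂ)) (hB₂ : DifferentiableOn ℂ (fun w : ℂ => B₂ (conj w)) {w : ℂ | conj w ∈ D₁}) (hB₃ : DifferentiableOn ℂ B₃ D₁)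
    (hB₃₂ : ∀ z ∈ D₁, B₃ z = conj (B₂ z)) (hB₄₁ : ∀ z' ∈ D₁, DifferentiableOn ℂ (fun z : ℂ => B₄ z z') D₁)
    (hB₄₂ : ∀ z ∈ D₁, DifferentiableOn ℂ (fun w : ℂ => B₄ z (conj w)) {w : ℂ | conj w ∈ D₁}) (hB₄d : ∀ z ∈ D₁, B₄ z z = ((b z : ℝ) : ℂ))
    (hCS : ∀ z ∈ D₁, ‖B₂ z‖ ^ 2 ≤ a * b z)
    (φ : (quasiSplit (↥(maximalRealSubfield L)) L (IsCMField.complexConj L) 2).Adelic → ℂ)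
    (F : ℂ → Lp ℂ 2 μ) (hFd : DifferentiableOn ℂ F D₁)
    (hFtube : ∀ z ∈ D₁, 1 < z.re → ((F z : Lp ℂ 2 μ) : (quasiSplit (↥(maximalRealSubfield L)) L (IsCMField.complexConj L) 2).automorphicQuotient → ℂ) =ᵐ[μ] (quasiSplit (↥(maximalRealSubfield L)) L (IsCMField.complexConj L) 2).quotFun (truncation ν 𝓕 T (eisensteinSeriesU (flatSectionU φ z))))
    (h4 : ∀ z z' : ℂ, 1 < z'.re → z'.re < z.re →
      ∫ x, (quasiSplit (↥(maximalRealSubfield L)) L (IsCMField.complexConj L) 2).quotFun (truncation ν 𝓕 T (eisensteinSeriesU (flatSectionU φ z))) x * conj ((quasiSplit (↥(maximalRealSubfield L)) L (IsCMField.complexConj L) 2).quotFun (truncation ν 𝓕 T (eisensteinSeriesU (flatSectionU φ z'))) x) ∂μ =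
      ((cμ : ℝ) : ℂ) * (((K : ℝ) : ℂ) *
        ((((T : ℝ) : ℂ) ^ (z + conj z' - 1) / (z + conj z' - 1)) * B₁
          + (((T : ℝ) : ℂ) ^ (z - conj z') / (z - conj z')) * B₂ z'
          - (((T : ℝ) : ℂ) ^ (-(z - conj z')) / (z - conj z')) * B₃ z
          - (((T : ℝ) : ℂ) ^ (-(z + conj z' - 1)) / (z + conj z' - 1)) * B₄ z z')))
    {z : ℂ} (hz : z ∈ D₁) :
    Real.sqrt (b z) ≤ (z.re - 1 / 2) * (T : ℝ) ^ (2 * (z.re - 1 / 2)) * Real.sqrt a / |z.im| +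
        Real.sqrt ((z.re - 1 / 2) ^ 2 * (T : ℝ) ^ (4 * (z.re - 1 / 2)) * a / z.im ^ 2 + a * (T : ℝ) ^ (4 * (z.re - 1 / 2))) ∧
      (∀ {x₁ x₂ η : ℝ}, 0 < x₁ → (z.re - 1 / 2) ∈ Set.Icc x₁ x₂ → 0 < η → η ≤ |z.im| →
        b z ≤ (x₂ * (T : ℝ) ^ (2 * x₂) * Real.sqrt a / η + Real.sqrt (x₂ ^ 2 * (T : ℝ) ^ (4 * x₂) * a / η ^ 2 + a * (T : ℝ) ^ (4 * x₂))) ^ 2) ∧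
      (|z.im| ≤ 1 → b z ≤ ((z.re - 1 / 2) * (T : ℝ) ^ (2 * (z.re - 1 / 2)) * Real.sqrt a +
        Real.sqrt ((z.re - 1 / 2) ^ 2 * (T : ℝ) ^ (4 * (z.re - 1 / 2)) * a + a * (T : ℝ) ^ (4 * (z.re - 1 / 2)))) ^ 2 / z.im ^ 2) := by
  have hraw : ∀ z ∈ D₁, ∀ z' ∈ D₁, 1 < z.re → 1 < z'.re →
      ⟪F z', F z⟫_ℂ = ∫ x, (quasiSplit (↥(maximalRealSubfield L)) L (IsCMField.complexConj L) 2).quotFun (truncation ν 𝓕 T (eisensteinSeriesU (flatSectionU φ z))) x * conj ((quasiSplit (↥(maximalRealSubfield L)) L (IsCMField.complexConj L) 2).quotFun (truncation ν 𝓕 T (eisensteinSeriesU (flatSectionU φ z'))) x) ∂μ := by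
    intro z hz z' hz' hz1 hz'1
    rw [MeasureTheory.L2.inner_def]
    refine integral_congr_ae ?_
    filter_upwards [hFtube z hz hz1, hFtube z' hz' hz'1] with x hx hx'
    rw [hx, hx', RCLike.inner_apply, mul_comm]
  have hrel : ∀ z ∈ D₁, ∀ z' ∈ D₁, 1 < z'.re → z'.re < z.re →
      ⟪F z', F z⟫_ℂ = ((cμ : ℝ) : ℂ) * (((K : ℝ) : ℂ) *
        ((((T : ℝ) : ℂ) ^ (z + conj z' - 1) / (z + conj z' - 1)) * B₁
          + (((T : ℝ) : ℂ) ^ (z - conj z') / (z - conj z')) * B₂ z'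
          - (((T : ℝ) : ℂ) ^ (-(z - conj z')) / (z - conj z')) * B₃ z
          - (((T : ℝ) : ℂ) ^ (-(z + conj z' - 1)) / (z + conj z' - 1)) * B₄ z z')) := by
    intro z hz z' hz' h1 h2
    rw [hraw z hz z' hz' (h1.trans h2) h1]
    exact h4 z z' h1 h2
  exact poleControl_continued_chi_cm_two_of_family_lower_on' hD₁ hD₁c hD₁sub hO₁ hO₁ne hO₁D hO₂' hO₂'ne hO₂'D hsep (T := (T : ℝ)) (by exact_mod_cast hT) hcμ hK ha hb hB₁ hB₂ hB₃ hB₃₂ hB₄₁ hB₄₂ hB₄d hCS F hFd hrel hz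

end Lower

end Summit.HodgeConjecture.HodgeConjecture.Cruxes.H413.K2E1ChiMaassSelbergContinuedLowerCMTwo

end
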